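/-
Origin: expansion seat `planner-pub-hodgecm-pv09-g6-0`, handover #2 2026-08-18T11:38:00Z (`HOME/pub-hodgecm-pv09-g6/lean/Pv09g6/GenuineTensorModel.lean`, md5 49f3d512, 546 lines);
landed by the gen-8 packager in gate run 29 as `HodgeCM/PerL34/GenuineTensorModel.lean` (import ^import Pv09g6\.RestrictedTensor[ \t]*$→import HodgeCM.PerL34.RestrictedTensor ×1).
-/
/-
Copyright: HodgeCM publication cell (pub-hodgecm), seam S3 (𝓕-side / genuine idelic torus end; the
representation-side INPUT of `GenuineThetaInput`, INHABITED).  Prover seat pub-hodgecm-pv09-g6 (DAG-node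
prover #09, generation 6), file #2 (HANDOVER #2); intended final place
`HodgeCM/PerL34/GenuineTensorModel.lean`.  WIP import: `Pv09g6.RestrictedTensor` ↦
`HodgeCM.PerL34.RestrictedTensor` (this seat, HANDOVER #1).  Complete proofs, no new axioms, nothing cited.
Released under the package licence.
-/
import Summits.HodgeConjecture.HodgeCM.PerL34.RestrictedTensor_2
import Summits.HodgeConjecture.HodgeCM.PerL34.GenuineThetaInput
import Mathlib.MeasureTheory.Function.LpSpace.ContinuousCompMeasurePreserving
import Mathlib.Topology.CompactOpen

/-!
# The genuine torus `U(1)_{L/L⁺}`: the restricted tensor product MODEL, and `GenuineThetaInput` INHABITED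

Seam S3 (𝓕-side), node ledger row "S3 input".  `HodgeCM/PerL34/GenuineThetaInput.lean` (pv09-g5, r27) packages
the sixteen representation-side binders of the genuine headline
`PureTensor.exists_compactDomain_thetaLift_ne_zero_genuine_base` as ONE `Type`-valued structure
`PureTensor.GenuineThetaInput L S Sp ω φ χ`, "never assumed inhabited anywhere in the package".  This file
INHABITS it — for EVERY CM field `L`, EVERY finite set `S` of places of `L⁺`, every global unitary character `χ`
of some level `K_{T'}`, every family of local unitary characters `ν_i` of `(L⁺_{v(i)})ˣ` unramified off `S`, and
every choice of balls `B(x₀_i, r_i)` (`0 < r_i < |x₀_i|`) at the split places of `S` on which `ν_i` and `χ_i` are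
trivial — in the restricted Hilbert tensor product (`HodgeCM/PerL34/RestrictedTensor.lean`, this seat's file #1)

  `Sp := ⊗′_i (H_i, e_i)`, `H_i := L²((L⁺_{v(i)})³, μ_{v(i)})`, `e_i := 1_{𝒪³}` (`vol 𝒪³ = 1`),
  `ω := ⊗′_i ρ_i`,  `ρ_i := ω_{ν_i} ∘ baseTriv_i` (the dilation representation of `(L⁺_v)ˣ`,
         `LocalFactors.DilationModel.dilationRep`) at a split index, `ρ_i := conj χ_i · id` at a non-split index,
  `φ := φ• := ⊗_i φ•_i`, `φ•_i := vol(B)^{-1/2} · 1_{B(x₀_i, r_i)}` at the split places of `S`, `e_i` elsewhere,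

(`Genuine.thetaInput`), together with the four `(ω, φ)`-hypotheses of the S3 END
`PureTensor.exists_compactDomain_thetaLift_ne_zero_genuine_of_input` in their END shape:
`(hφ)` `Genuine.norm_phi`, `(hK)` `Genuine.rep_phi_eq_self` (level `K_{S ∪ T'}`), `(hM)`
`Genuine.inner_phi_rep_extendOne` (on EVERY finite `S₁`, no `T ⊆ S₁` needed), `(hloc)`
`Genuine.continuous_rep_mulSingle_apply` (for EVERY vector of `⊗′H`, from continuity of the `ν_i` and of the
`χ_i`, `i ∈ T'`).  `Genuine.smoke` / `Genuine.smokeInput`: with `ν_i = 1`, `χ = 1`, `x₀_i = (1,1,1)`, `r_i = 1/2`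
NO hypothesis is left — `GenuineThetaInput L S (⊗′H) ω₁ φ₁ 1` is inhabited outright, for every `L` and `S`.

Ingredients proved here (§A, §B), all elementary: a unitary representation continuous at `1` on one vector has a
continuous orbit map; the scalar representation of a unitary character; for ONE split place — `|u| = 1 ⇒`
`x ↦ u • x` preserves Haar measure on `Fⁿ` and `ω_ν(u) = ν(u) • (Mathlib's Lp.compMeasurePreserving)`, whence
**strong continuity of the dilation representation on all of `L²(Fⁿ)`** from continuity of `ν`
(Mathlib `Continuous.compMeasurePreservingLp` on the open subgroup of norm-one units + the orbit lemma); the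
spherical vector `ω_ν(u) 1_{B(0,R)} = 1_{B(0,R)}` (`|u| = 1`, `ν(u) = 1`); `‖1_{B(x₀,r)}‖₂ = vol^{1/2}`.

HONEST LIMITS.  (1) This is the TORUS-SIDE model: `ω` is a unitary representation of the model group
`Model L ≅ U(1)_{L/L⁺}(𝔸_{L⁺})` on `⊗′H`; it is NOT exhibited as the restriction `D.ω|torus` of an ambient
`DoublingDatum D` of `U(W)(𝔸)` (the adelic theta / Weil representation MODEL — cell answer (b), not this lane), and
the END theorem quantifies over such a `D`; so this file discharges "the input structure is consistent and every
`(ω, φ)`-hypothesis of the END is satisfiable, by an explicit model", not the END's `D`-binders.  (2) `hiso`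
(PRINT: PerL v5 l. 616, isotypy at the non-split places) holds here BY CONSTRUCTION (scalar local factor
`conj χ_i`); its mathematical content for the actual theta lift is untouched.  (3) Nothing is cited; no axiom beyond
Lean's three; Mathlib v4.32.0 names only.
-/

set_option autoImplicit false

noncomputable section

open MeasureTheory MeasureTheory.Measure Set Metric Function Complex ComplexConjugate Topology Filter
open scoped RestrictedProduct InnerProductSpace NNReal ENNReal

namespace HodgeCM.PerL34.RestrictedTensor

open HodgeCM.PerL34.LocalFactors HodgeCM.PerL34.LocalFactors.DilationModel

/-! ## §A  Unitary representations: strong continuity from continuity at `1`; scalar representations -/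

section Unitary

variable {G : Type*} [Group G] {E : Type*} [NormedAddCommGroup E] [NormedSpace ℂ E]

/-- a unitary representation whose orbit map `g ↦ ρ(g) v` is continuous at `1` has a continuous orbit map. -/
theorem continuous_apply_of_continuousAt_one [TopologicalSpace G] [ContinuousMul G]
    (ρ : G →* (E ≃ₗᵢ[ℂ] E)) (v : E)
    (h : ContinuousAt (fun g => ρ g v) 1) : Continuous fun g => ρ g v := by
  refine continuous_iff_continuousAt.2 fun g₀ => ?_
  have hm : ContinuousAt (fun g : G => g₀⁻¹ * g) g₀ := (continuous_const.mul continuous_id).continuousAt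
  have h1 : ContinuousAt (fun g => ρ g v) (g₀⁻¹ * g₀) := by rwa [inv_mul_cancel]
  have hc : ContinuousAt (fun g => ρ g₀ (ρ (g₀⁻¹ * g) v)) g₀ :=
    (ρ g₀).continuous.continuousAt.comp (ContinuousAt.comp h1 hm)
  refine hc.congr (Eventually.of_forall fun g => ?_)
  change ρ g₀ (ρ (g₀⁻¹ * g) v) = ρ g v
  rw [← Function.comp_apply (f := ρ g₀), ← LinearIsometryEquiv.coe_mul, ← map_mul, mul_inv_cancel_left]


/-- multiplication by a unit complex number, as a linear isometric equivalence. -/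
def unitScalar (z : Circle) : E ≃ₗᵢ[ℂ] E where
  toFun v := (z : ℂ) • v
  map_add' := smul_add _
  map_smul' c v := smul_comm _ _ _
  invFun v := ((z⁻¹ : Circle) : ℂ) • v
  left_inv v := by
    simp only [smul_smul, ← Circle.coe_mul, inv_mul_cancel, Circle.coe_one, one_smul]
  right_inv v := by
    simp only [smul_smul, ← Circle.coe_mul, mul_inv_cancel, Circle.coe_one, one_smul]
  norm_map' v := by
    change ‖(z : ℂ) • v‖ = ‖v‖
    rw [norm_smul, Circle.norm_coe, one_mul]

/-- (Ported verbatim from the HodgeCMPerL package; no docstring in the source.) -/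
@[simp] theorem unitScalar_apply (z : Circle) (v : E) : unitScalar z v = (z : ℂ) • v := rfl

/-- **the scalar unitary representation** `g ↦ c(g) · id` of a unitary character `c`. -/
def scalarRep (c : G →* Circle) : G →* (E ≃ₗᵢ[ℂ] E) where
  toFun g := unitScalar (c g)
  map_one' := LinearIsometryEquiv.ext fun v => by
    rw [unitScalar_apply, map_one, Circle.coe_one, one_smul]; rfl
  map_mul' g h := LinearIsometryEquiv.ext fun v => by
    rw [unitScalar_apply, map_mul, Circle.coe_mul, mul_smul, LinearIsometryEquiv.coe_mul,
      Function.comp_apply, unitScalar_apply, unitScalar_apply]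

/-- (Ported verbatim from the HodgeCMPerL package; no docstring in the source.) -/
@[simp] theorem scalarRep_apply (c : G →* Circle) (g : G) (v : E) : scalarRep c g v = (c g : ℂ) • v := rfl

/-- (Ported verbatim from the HodgeCMPerL package; no docstring in the source.) -/
theorem continuous_scalarRep_apply [TopologicalSpace G] (c : G →* Circle) (hc : Continuous c) (v : E) :
    Continuous fun g => scalarRep (E := E) c g v := by
  change Continuous fun g => ((c g : Circle) : ℂ) • v
  exact (continuous_subtype_val.comp hc).smul continuous_const

end Unitary

/-! ## §B  One split place: strong continuity and the spherical vector of the dilation representation -/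

section Local

variable {F : Type} [NormedField F] [IsUltrametricDist F] [ProperSpace F] {n : ℕ}
  [MeasurableSpace (Fin n → F)] [BorelSpace (Fin n → F)]
  (μ : Measure (Fin n → F)) [μ.IsAddHaarMeasure]

omit [IsUltrametricDist F] [ProperSpace F] [MeasurableSpace (Fin n → F)] [BorelSpace (Fin n → F)] in
/-- `|u| = 1 ⇒ u⁻¹ · B(0,R) = B(0,R)` in `Fⁿ` (sup norm). -/
theorem preimage_unit_smul_closedBall_zero (u : Fˣ) (hu : ‖(u : F)‖ = 1) (R : ℝ) :
    (fun x : Fin n → F => u • x) ⁻¹' closedBall 0 R = closedBall 0 R := by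
  ext x
  simp only [mem_preimage, mem_closedBall_zero_iff, Units.smul_def, norm_smul, hu, one_mul]

omit [MeasurableSpace (Fin n → F)] [BorelSpace (Fin n → F)] in
/-- for `|u| = 1` the weight `ν(u) δ(u)^{1/2}` of the dilation operator is `ν(u)`. -/
theorem weight_eq_coe_of_norm_eq_one (ν : Fˣ →* Circle) (u : Fˣ) (hu : ‖(u : F)‖ = 1) :
    weight (Fin n → F) ν u = (ν u : ℂ) := by
  rw [weight, DilationModel.distribHaarChar_eq_one_of_norm_eq_one n u hu, NNReal.sqrt_one, NNReal.coe_one,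
    Complex.ofReal_one, mul_one]

/-- a norm-one unit acts on `(Fⁿ, Haar)` by a measure-preserving map. -/
theorem measurePreserving_unit_smul (u : Fˣ) (hu : ‖(u : F)‖ = 1) :
    MeasurePreserving (fun x : Fin n → F => u • x) μ μ := by
  refine ⟨measurable_const_smul u, ?_⟩
  rw [map_smul_eq μ u, DilationModel.distribHaarChar_eq_one_of_norm_eq_one n u hu, inv_one, one_smul]

/-- on norm-one units the dilation operator IS `ν(u) •` Mathlib's measure-preserving pull-back. -/
theorem dilationRep_eq_smul_compMeasurePreserving (ν : Fˣ →* Circle) (u : Fˣ) (hu : ‖(u : F)‖ = 1)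
    (f : Lp ℂ 2 μ) :
    dilationRep μ ν u f =
      (ν u : ℂ) • Lp.compMeasurePreserving (fun x : Fin n → F => u • x)
        (measurePreserving_unit_smul μ u hu) f := by
  apply Lp.ext
  refine (coeFn_dilationRep μ ν u f).trans ?_
  refine Filter.EventuallyEq.trans ?_ (Lp.coeFn_smul _ _).symm
  filter_upwards [Lp.coeFn_compMeasurePreserving f (measurePreserving_unit_smul μ u hu)] with x hx
  rw [Pi.smul_apply, hx, weight_eq_coe_of_norm_eq_one ν u hu, smul_eq_mul, Function.comp_apply]

omit [IsUltrametricDist F] [ProperSpace F] [MeasurableSpace (Fin n → F)] [BorelSpace (Fin n → F)] in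
/-- the norm-one units form an open subset of `Fˣ` (ultrametric: the unit sphere is open). -/
theorem isOpen_setOf_norm_eq_one [IsUltrametricDist F] : IsOpen {y : Fˣ | ‖(y : F)‖ = 1} := by
  have hs : {y : Fˣ | ‖(y : F)‖ = 1} = Units.val ⁻¹' sphere (0 : F) 1 := by
    ext y
    simp only [mem_setOf_eq, mem_preimage, mem_sphere, dist_zero_right]
  rw [hs]
  exact (IsUltrametricDist.isOpen_sphere (0 : F) one_ne_zero).preimage Units.continuous_val

/-- **the spherical vector**: a norm-one unit in the kernel of `ν` fixes `1_{B(0,R)}`. -/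
theorem dilationRep_ballIndicator_zero (ν : Fˣ →* Circle) (u : Fˣ) (hu : ‖(u : F)‖ = 1) (hν : ν u = 1)
    (R : ℝ) : dilationRep μ ν u (ballIndicator μ 0 R) = ballIndicator μ 0 R := by
  rw [ballIndicator, dilationRep_indicatorConstLp, weight_eq_coe_of_norm_eq_one ν u hu, hν, Circle.coe_one,
    one_smul]
  refine Lp.ext (indicatorConstLp_coeFn.trans (Filter.EventuallyEq.trans ?_ indicatorConstLp_coeFn.symm))
  rw [preimage_unit_smul_closedBall_zero u hu R]

omit [IsUltrametricDist F] in
/-- `‖1_{B(x₀,r)}‖₂ = vol(B(x₀,r))^{1/2}` -/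
theorem norm_ballIndicator (x₀ : Fin n → F) (r : ℝ) :
    ‖ballIndicator μ x₀ r‖ = (μ.real (closedBall x₀ r)) ^ (1 / 2 : ℝ) := by
  rw [ballIndicator, norm_indicatorConstLp two_ne_zero ENNReal.ofNat_ne_top, norm_one, one_mul,
    ENNReal.toReal_ofNat]

omit [IsUltrametricDist F] in
/-- (Ported verbatim from the HodgeCMPerL package; no docstring in the source.) -/
theorem norm_ballIndicator_of_measureReal_eq_one (x₀ : Fin n → F) (r : ℝ)
    (h : μ.real (closedBall x₀ r) = 1) : ‖ballIndicator μ x₀ r‖ = 1 := by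
  rw [norm_ballIndicator, h, Real.one_rpow]

omit [IsUltrametricDist F] [BorelSpace (Fin n → F)] in
/-- (Ported verbatim from the HodgeCMPerL package; no docstring in the source.) -/
theorem measureReal_closedBall_pos (x₀ : Fin n → F) {r : ℝ} (hr : 0 < r) :
    0 < μ.real (closedBall x₀ r) :=
  ENNReal.toReal_pos (measure_closedBall_pos μ x₀ hr).ne' (isCompact_closedBall _ _).measure_lt_top.ne

/-- the normalising scalar `a = vol(B(x₀,r))^{-1/2}` -/
def ballScalar (x₀ : Fin n → F) (r : ℝ) : ℂ := (((μ.real (closedBall x₀ r)) ^ (1 / 2 : ℝ))⁻¹ : ℝ)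

omit [IsUltrametricDist F] in
/-- `‖a • 1_{B(x₀,r)}‖ = 1` for `a = vol^{-1/2}`, `r > 0`. -/
theorem norm_ballScalar_smul_ballIndicator (x₀ : Fin n → F) {r : ℝ} (hr : 0 < r) :
    ‖ballScalar μ x₀ r • ballIndicator μ x₀ r‖ = 1 := by
  have hpos : 0 < (μ.real (closedBall x₀ r)) ^ (1 / 2 : ℝ) :=
    Real.rpow_pos_of_pos (measureReal_closedBall_pos μ x₀ hr) _
  rw [norm_smul, norm_ballIndicator, ballScalar, Complex.norm_real, Real.norm_eq_abs,
    abs_of_pos (inv_pos.2 hpos), inv_mul_cancel₀ hpos.ne']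

/-- **strong continuity of the dilation representation** `y ↦ ω_ν(y) f` for EVERY `f ∈ L²(Fⁿ)`, from
continuity of `ν`: on the open subgroup of norm-one units the action is by measure-preserving homeomorphisms
depending continuously on `y` (Mathlib `Continuous.compMeasurePreservingLp`), and a unitary representation
continuous at `1` is strongly continuous. -/
theorem continuous_dilationRep_apply (ν : Fˣ →* Circle) (hν : Continuous ν) (f : Lp ℂ 2 μ) :
    Continuous fun y : Fˣ => dilationRep μ ν y f := by
  set U : Set Fˣ := {y : Fˣ | ‖(y : F)‖ = 1}
  have hU1 : U ∈ 𝓝 (1 : Fˣ) :=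
    isOpen_setOf_norm_eq_one.mem_nhds (by simp only [mem_setOf_eq, Units.val_one, norm_one])
  let g : U → C(Fin n → F, Fin n → F) := fun u => ⟨fun x => (u.1 : Fˣ) • x, continuous_const_smul _⟩
  have hg : Continuous g :=
    ContinuousMap.continuous_of_continuous_uncurry g
      ((continuous_subtype_val.comp continuous_fst).smul continuous_snd)
  have hgm : ∀ u : U, MeasurePreserving (g u) μ μ := fun u => measurePreserving_unit_smul μ u.1 u.2
  have hcU : Continuous fun u : U => dilationRep μ ν u.1 f := by
    have h2 : (fun u : U => dilationRep μ ν u.1 f) =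
        fun u : U => ((ν u.1 : Circle) : ℂ) • Lp.compMeasurePreserving (g u) (hgm u) f :=
      funext fun u => dilationRep_eq_smul_compMeasurePreserving μ ν u.1 u.2 f
    rw [h2]
    exact (continuous_subtype_val.comp (hν.comp continuous_subtype_val)).smul
      (continuous_const.compMeasurePreservingLp hg hgm ENNReal.ofNat_ne_top)
  have h1 : ContinuousAt (fun y : Fˣ => dilationRep μ ν y f) 1 :=
    (continuousOn_iff_continuous_restrict.2 hcU).continuousAt hU1
  exact continuous_apply_of_continuousAt_one (dilationRep μ ν) f h1

end Local


/-! ## §C  The genuine torus `U(1)_{L/L⁺}`: the restricted tensor product model and the INHABITED input -/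

namespace Genuine

open NumberField IsDedekindDomain HodgeCM.PerL34.IdelePlaces HodgeCM.PerL34.NoSmallSubgroups
open HodgeCM.PerL34.IdelicTorusModel HodgeCM.PerL34.IdelicTorusModel.Genuine HodgeCM.PerL34.PureTensor

attribute [local instance] LocalFactors.DilationModel.Adic.nontriviallyNormedField
  LocalFactors.DilationModel.Adic.properSpace

variable (L : Type) [Field L] [NumberField L]
  [∀ v : HeightOneSpectrum (𝓞 (maximalRealSubfield L)), MeasurableSpace (v.adicCompletion (maximalRealSubfield L))]
  [∀ v : HeightOneSpectrum (𝓞 (maximalRealSubfield L)), BorelSpace (v.adicCompletion (maximalRealSubfield L))]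

/-- the local Hilbert spaces `H_i := L²((L⁺_{v(i)})³, μ_v)` at EVERY index `i` (`v(i) = basePlaceOf L i`; at a
non-split index only the line `ℂ · 1_{𝒪³}` of `H_i` is ever reached). -/
abbrev LocH (i : Place (maximalRealSubfield L)) : Type :=
  Lp ℂ 2 (Adic.muV (maximalRealSubfield L) (basePlaceOf L i))

/-- the reference unit vectors `e_i := 1_{𝒪_v³}` (`vol 𝒪_v³ = 1`). -/
def unitFam : UnitFamily (LocH L) where
  e i := ballIndicator (Adic.muV (maximalRealSubfield L) (basePlaceOf L i)) 0 1
  norm_e i := norm_ballIndicator_of_measureReal_eq_one _ 0 1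
    (Adic.muV_real_closedBall (maximalRealSubfield L) (basePlaceOf L i))

/-- (Ported verbatim from the HodgeCMPerL package; no docstring in the source.) -/
@[simp] theorem unitFam_e (i : Place (maximalRealSubfield L)) :
    (unitFam L).e i = ballIndicator (Adic.muV (maximalRealSubfield L) (basePlaceOf L i)) 0 1 := rfl

variable [IsCMField L] [DecidableEq (Place (maximalRealSubfield L))] (χ : Model L →* Circle)
  (ν : ∀ i : Place (maximalRealSubfield L), ((basePlaceOf L i).adicCompletion (maximalRealSubfield L))ˣ →* Circle)

/-- the local component `χ_i := χ ∘ ι_i` of the global character. -/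
def locChar (i : Place (maximalRealSubfield L)) : locTorus (maximalRealSubfield L) L i →* Circle :=
  χ.comp (PureTensor.inclHom (genLevel L) i)

omit [∀ v : HeightOneSpectrum (𝓞 (maximalRealSubfield L)), MeasurableSpace (v.adicCompletion (maximalRealSubfield L))]
  [∀ v : HeightOneSpectrum (𝓞 (maximalRealSubfield L)), BorelSpace (v.adicCompletion (maximalRealSubfield L))]
  [IsCMField L] in
/-- (Ported verbatim from the HodgeCMPerL package; no docstring in the source.) -/
@[simp] theorem locChar_apply (i : Place (maximalRealSubfield L)) (g : locTorus (maximalRealSubfield L) L i) :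
    locChar L χ i g = χ (RestrictedProduct.mulSingle (genLevel L) i g) := rfl

open scoped Classical in
/-- **the local representations**: at a split index the dilation representation `ω_{ν_i}` of `(L⁺_v)ˣ` on
`L²((L⁺_v)³)` read through the base chart `baseTriv`; at a non-split index the scalar representation
`g ↦ conj χ_i(g) = χ_i(g)⁻¹`. -/
def locRep (i : Place (maximalRealSubfield L)) :
    locTorus (maximalRealSubfield L) L i →* (LocH L i ≃ₗᵢ[ℂ] LocH L i) :=
  if hs : IsSplitPlace L i then
    (dilationRep (Adic.muV (maximalRealSubfield L) (basePlaceOf L i)) (ν i)).comp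
      (baseTriv L i hs : locTorus (maximalRealSubfield L) L i →* _)
  else scalarRep (locChar L χ i)⁻¹

/-- (Ported verbatim from the HodgeCMPerL package; no docstring in the source.) -/
theorem locRep_apply_of_isSplitPlace (i : Place (maximalRealSubfield L)) (hs : IsSplitPlace L i)
    (g : locTorus (maximalRealSubfield L) L i) :
    locRep L χ ν i g = dilationRep (Adic.muV (maximalRealSubfield L) (basePlaceOf L i)) (ν i) (baseTriv L i hs g) := by
  rw [locRep, dif_pos hs, MonoidHom.comp_apply, MonoidHom.coe_coe]

/-- (Ported verbatim from the HodgeCMPerL package; no docstring in the source.) -/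
theorem locRep_apply_of_not_isSplitPlace (i : Place (maximalRealSubfield L)) (hs : ¬IsSplitPlace L i)
    (g : locTorus (maximalRealSubfield L) L i) (v : LocH L i) :
    locRep L χ ν i g v = conj ((χ (RestrictedProduct.mulSingle (genLevel L) i g) : Circle) : ℂ) • v := by
  rw [locRep, dif_neg hs, scalarRep_apply, MonoidHom.inv_apply, Circle.coe_inv_eq_conj, locChar_apply]

omit [∀ v : HeightOneSpectrum (𝓞 (maximalRealSubfield L)), MeasurableSpace (v.adicCompletion (maximalRealSubfield L))]
  [∀ v : HeightOneSpectrum (𝓞 (maximalRealSubfield L)), BorelSpace (v.adicCompletion (maximalRealSubfield L))]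
  [IsCMField L] in
variable {χ} in
/-- a character of level `K_{T'}` kills `ι_i(b)` for `i ∉ T'`, `b ∈ B_i`. -/
theorem chi_mulSingle_eq_one {T' : Finset (Place (maximalRealSubfield L))}
    (hχT' : RestrictedProduct.boxSubgroup (genLevel L) T' ≤ χ.ker) {i : Place (maximalRealSubfield L)}
    (hi : i ∉ T') {b : locTorus (maximalRealSubfield L) L i} (hb : b ∈ genLevel L i) :
    χ (RestrictedProduct.mulSingle (genLevel L) i b) = 1 := by
  refine (MonoidHom.mem_ker).1 (hχT' ((RestrictedProduct.mem_boxSubgroup_iff T' _).2 ⟨fun j => ?_, fun j hj => ?_⟩))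
  · by_cases hji : j = i
    · subst hji; rw [RestrictedProduct.mulSingle_eq_same]; exact hb
    · rw [RestrictedProduct.mulSingle_eq_of_ne _ _ hji]; exact one_mem _
  · exact RestrictedProduct.mulSingle_eq_of_ne _ _ (by rintro rfl; exact hi hj)

variable {χ ν} in
/-- off `S ∪ T'` the level subgroup `B_i` fixes `e_i` (spherical vector / trivial scalar). -/
theorem locRep_e {S T' : Finset (Place (maximalRealSubfield L))}
    (hν : ∀ i, i ∉ S → IsSplitPlace L i → ∀ u : ((basePlaceOf L i).adicCompletion (maximalRealSubfield L))ˣ,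
      ‖(u : (basePlaceOf L i).adicCompletion (maximalRealSubfield L))‖ = 1 → ν i u = 1)
    (hχT' : RestrictedProduct.boxSubgroup (genLevel L) T' ≤ χ.ker)
    {i : Place (maximalRealSubfield L)} (hiS : i ∉ S) (hiT : i ∉ T')
    {b : locTorus (maximalRealSubfield L) L i} (hb : b ∈ genLevel L i) :
    locRep L χ ν i b ((unitFam L).e i) = (unitFam L).e i := by
  by_cases hs : IsSplitPlace L i
  · have h1 : ‖((baseTriv L i hs b : ((basePlaceOf L i).adicCompletion (maximalRealSubfield L))ˣ) :
        (basePlaceOf L i).adicCompletion (maximalRealSubfield L))‖ = 1 :=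
      (mem_genLevel_iff_norm_baseTriv_eq_one L i hs b).1 hb
    rw [locRep_apply_of_isSplitPlace, unitFam_e]
    exact dilationRep_ballIndicator_zero _ (ν i) _ h1 (hν i hiS hs _ h1) 1
  · rw [locRep_apply_of_not_isSplitPlace L χ ν i hs, chi_mulSingle_eq_one L hχT' hiT hb, Circle.coe_one, map_one,
      one_smul]

variable {χ ν} in
/-- **admissibility**: `(ρ_i, B_i)` fixes `e_i` for all `i ∉ S ∪ T'`. -/
theorem admissible {S T' : Finset (Place (maximalRealSubfield L))}
    (hν : ∀ i, i ∉ S → IsSplitPlace L i → ∀ u : ((basePlaceOf L i).adicCompletion (maximalRealSubfield L))ˣ,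
      ‖(u : (basePlaceOf L i).adicCompletion (maximalRealSubfield L))‖ = 1 → ν i u = 1)
    (hχT' : RestrictedProduct.boxSubgroup (genLevel L) T' ≤ χ.ker) :
    Admissible (unitFam L) (genLevel L) (locRep L χ ν) :=
  ((S ∪ T').eventually_cofinite_notMem).mono fun _ hi _ hb =>
    locRep_e L hν hχT' (fun h => hi (Finset.mem_union_left _ h)) (fun h => hi (Finset.mem_union_right _ h)) hb

/-! ### The distinguished vector `φ• = ⊗ φ•_i` -/

variable (S : Finset (Place (maximalRealSubfield L)))
  (x₀ : ∀ i : Place (maximalRealSubfield L), Fin 3 → (basePlaceOf L i).adicCompletion (maximalRealSubfield L))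
  (r : Place (maximalRealSubfield L) → ℝ)

/-- the normalising scalars `a_i := vol(B(x₀_i, r_i))^{-1/2}`. -/
def ballA (i : Place (maximalRealSubfield L)) : ℂ :=
  ballScalar (Adic.muV (maximalRealSubfield L) (basePlaceOf L i)) (x₀ i) (r i)

open scoped Classical in
/-- the local vectors: `a_i · 1_{B(x₀_i, r_i)}` at the split places of `S`, `e_i = 1_{𝒪³}` elsewhere. -/
def phiFam : RVec (unitFam L) where
  val i := if i ∈ S ∧ IsSplitPlace L i then
      ballA L x₀ r i • ballIndicator (Adic.muV (maximalRealSubfield L) (basePlaceOf L i)) (x₀ i) (r i)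
    else (unitFam L).e i
  eventually_eq := S.eventually_cofinite_notMem.mono fun _ hi => if_neg fun h => hi h.1

/-- (Ported verbatim from the HodgeCMPerL package; no docstring in the source.) -/
theorem phiFam_apply_of_mem (i : Place (maximalRealSubfield L)) (hi : i ∈ S) (hs : IsSplitPlace L i) :
    phiFam L S x₀ r i =
      ballA L x₀ r i • ballIndicator (Adic.muV (maximalRealSubfield L) (basePlaceOf L i)) (x₀ i) (r i) := by
  classical
  exact if_pos ⟨hi, hs⟩

/-- (Ported verbatim from the HodgeCMPerL package; no docstring in the source.) -/
theorem phiFam_apply_of_not (i : Place (maximalRealSubfield L)) (h : ¬(i ∈ S ∧ IsSplitPlace L i)) :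
    phiFam L S x₀ r i = (unitFam L).e i := by
  classical
  exact if_neg h

variable {r} in
/-- (Ported verbatim from the HodgeCMPerL package; no docstring in the source.) -/
theorem norm_phiFam (hr0 : ∀ i ∈ S, IsSplitPlace L i → 0 < r i) (i : Place (maximalRealSubfield L)) :
    ‖phiFam L S x₀ r i‖ = 1 := by
  by_cases h : i ∈ S ∧ IsSplitPlace L i
  · rw [phiFam_apply_of_mem L S x₀ r i h.1 h.2]
    exact norm_ballScalar_smul_ballIndicator _ _ (hr0 i h.1 h.2)
  · rw [phiFam_apply_of_not L S x₀ r i h]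
    exact (unitFam L).norm_e i


-- port_pkg: scope closed for this part
end Genuine
end HodgeCM.PerL34.RestrictedTensor
end
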